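/-
Copyright (c) 2026 the pub-hodgecm-mathlib formalisation cell (harness21).  Prover seat hodgecm-mathlib-K2E3-p21 (g2), HCML Track B «K2-LIT» (build stream 29),
h413 = `stmt-HodgeConjecture-24833`, line `K2_E3_EllipticInputs`, unit U3, line U3-d (lead K2E3-p03 (g0)), FILE C ASSEMBLY part 1 (deal `K2/STATUS.md`
2026-09-03T23:50:23Z): the pins that read the ‹SC-explicit› letters `hU`∕`hΨ` (typed on `G` through an isomorphism `e : G ≃ₜ* U(σ, J)(K)`) in K2E3-p01's model letters.  2026-09-04.
-/
import Summits.HodgeConjecture.HodgeConjecture.Theorems.K2E3UnipotentAdaptedFrame          -- ★ p855528 (this seat): `mem_ball_of_isNilpotent`; brings ★ `K2E3CayleyScalingMap` ((E) `cayleyScaling_conj`, `isUnit_of_mem_ball`, `conj_mem_ball`), ★ `cayley`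
import Literature.NumberTheory.Automorphic.UnitaryThreeUnipotentConjugacy                  -- ★ `isNilpotent_coe_conj_sub_one`
import Literature.NumberTheory.Automorphic.LocalOrbitalIntegral                            -- ★ `classOrbitalIntegral`, `orbitalIntegral_eq_integral_descConj`, `descConj_mk`
import Summits.HodgeConjecture.HodgeConjecture.Theorems.K2E3UnipotentOrbitalScalingRegular    -- ★ p855548 (K2E1b-p01, C2 (i′)): `exists_conj_coe_eq_cayley_smul_of_regular_unipotent` (typed at the literal `J₀`)
import HarnessLib

/-!
# h413 ∕ Track B «K2-LIT», line U3-d, FILE C ASSEMBLY, part 1: READING THE ‹SC-explicit› LETTERS THROUGH `e : G ≃ₜ* U(σ, J)(K)`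

Cell `pub/hodgecm-mathlib`, crux H413 = `stmt-HodgeConjecture-24833`, route of record `HCCMUnconditional`; chair K2-lead (g0), dealer K2E3-plan (g1), line lead of U3-d
K2E3-p03 (g0).  THEOREMS ONLY (no `def`, no `instance`, no `notation`, no named-fact hypothesis, no `sorry`); imports = ★ + HarnessLib; lane
`--supports stmt-HodgeConjecture-24833 --as helper` (count-neutral).

SETTING.  ‹SC-explicit› (the hypothesis `hSC` of ★ p855512 `K2E3CayleyScalingPackage.psiPackage_of_scalingLaw_local`) quantifies over pairs `(Ψ, U₀)` on
`G = U(Φ₃)(L⁺_v)` described THROUGH the one-place model `e = localNonsplitEquiv : G ≃ₜ* M`, `M = U(σ_w, J_w)(L_w)`: `hU : γ ∈ U₀ ↔ ‹eigenvalue-ball conditions on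
mat(e γ)›` and `hΨ : ∀ γ ∈ U₀, mat(e (Ψ γ)) = c(s • X_{e γ})`.  This file reads those two letters in K2E3-p01's MODEL letters (★ `K2E3CayleyScalingMap`: `hB` on a
ball `B ⊆ M`, `hΨ'` on a map `M → M`), for ANY isomorphism of topological groups `e : G ≃ₜ* M` (§1–§3) — so the assembly (part 2, `K2E3UnipotentOrbitalScalingLaw`) can quote ★ (E),
★ `mem_ball_of_isNilpotent` and the C1∕C2 heads — and supplies the identity-class case of the scaling law (§4).  Letters: `hU₀ : ∀ γ, γ ∈ U₀ ↔ e γ ∈ B` (with `B` the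
model ball of `hB`), `hΨ₀ : ∀ γ ∈ U₀, mat(e (Ψ γ)) = c(s • X_{e γ})`.
* §1 `mem_of_isNilpotent` (unipotent `γ` lies in `U₀`), `conj_mem_of_isNilpotent` (so do its conjugates: the `hU` letter of ★ p855453 §2), `one_mem`.
* §2 `coe_map_symm_and_inv` — the model map `Ψ' = e ∘ Ψ ∘ e⁻¹` satisfies K2E3-p01's TWO-conjunct letter `hΨ'` on `B` (the inverse conjunct `mat((Ψ'u)⁻¹) = c(−s•X_u)` from
  ★ `cayley_mul_cayley_neg`); hence (E) on `G`: `map_conj_eq_conj_map` (`Ψ(xγx⁻¹) = xΨ(γ)x⁻¹` for `γ ∈ U₀`, the `hE` letter of ★ p855453 §2).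
* §3 `map_one_eq_one` (`Ψ 1 = 1`), `map_eq_conj_of_coe_conj_eq` ((i′) of C1∕C2 at `e u₀` ⟹ `e (Ψ u₀) = h′·e u₀·h′⁻¹`, the input of ★ p855798's transport).
* §4 `classOrbitalIntegral_indicator_comp_eq_of_mk_one` — at the identity class, `Φ_m([1], 1_{U₀}·(F∘Ψ)) = Φ_m([1], F)` (exponent `a [1] = 0`).

HONEST LABEL.  HC_CM is proved only modulo the 7 printed citations (2 remaining named inputs: hLiu418 = `stmt-HodgeConjecture-24832`, h413 =
`stmt-HodgeConjecture-24833`) until rung 0 closes; count-neutral helper.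

## References
* [PlatonovRapinchuk1994] V. Platonov, A. Rapinchuk, *Algebraic Groups and Number Theory* (1994), §3.3 (Cayley parametrisation), §5.1 (one-place model).
* [HarishChandra1999AdmissibleDistributions] Harish-Chandra, *Admissible Invariant Distributions on Reductive p-adic Groups*, ULS 16 (1999), §3.1 Lemma 3.2.
* [Rogawski1990] J. D. Rogawski, *Automorphic Representations of Unitary Groups in Three Variables* (1990), §8.1 Prop. 8.1.2 (b) p. 114; §4.9 p. 54 (orbital integrals).
-/

set_option autoImplicit false
set_option linter.dupNamespace false  -- the mandated namespace repeats the single-problem summit's segment (`HodgeConjecture.HodgeConjecture`)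

noncomputable section

open MeasureTheory
open scoped Matrix MatrixGroups
open Literature.NumberTheory.Automorphic Literature.NumberTheory.Automorphic.UnitaryGroup Literature.NumberTheory.Weil1982.UnitaryFinTopForm
open Literature.MeasureTheory.Group
open Summit.HodgeConjecture.HodgeConjecture.Cruxes.H413.K2E3CayleyScalingModel Summit.HodgeConjecture.HodgeConjecture.Cruxes.H413.K2E3CayleyScalingMap
open Summit.HodgeConjecture.HodgeConjecture.Cruxes.H413.K2E3UnipotentAdaptedFrame

namespace Summit.HodgeConjecture.HodgeConjecture.Cruxes.H413.K2E3UnipotentOrbitalScalingLawPrelims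

section Model

variable {G : Type*} [Group G] [TopologicalSpace G] {K : Type*} [NormedField K] [IsUltrametricDist K] {σ : K →+* K} {J : Matrix (Fin 3) (Fin 3) K} {ρ : ℝ} {s : K}
  {B : Set ↥(unitaryGroupOfForm σ J)}
  (hB : ∀ u : ↥(unitaryGroupOfForm σ J), u ∈ B ↔
    IsUnit (((u : GL (Fin 3) K) : Matrix (Fin 3) (Fin 3) K) + 1).det ∧
    ‖((((u : GL (Fin 3) K) : Matrix (Fin 3) (Fin 3) K) - 1) * (((u : GL (Fin 3) K) : Matrix (Fin 3) (Fin 3) K) + 1)⁻¹).charpoly.coeff 2‖ ≤ ρ ∧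
    ‖((((u : GL (Fin 3) K) : Matrix (Fin 3) (Fin 3) K) - 1) * (((u : GL (Fin 3) K) : Matrix (Fin 3) (Fin 3) K) + 1)⁻¹).charpoly.coeff 1‖ ≤ ρ ^ 2 ∧
    ‖((((u : GL (Fin 3) K) : Matrix (Fin 3) (Fin 3) K) - 1) * (((u : GL (Fin 3) K) : Matrix (Fin 3) (Fin 3) K) + 1)⁻¹).charpoly.coeff 0‖ ≤ ρ ^ 3)
  (e : G ≃ₜ* ↥(unitaryGroupOfForm σ J)) {U₀ : Set G} (hU₀ : ∀ γ : G, γ ∈ U₀ ↔ e γ ∈ B)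
  {Ψ : G → G}
  (hΨ₀ : ∀ γ ∈ U₀, (((e (Ψ γ) : ↥(unitaryGroupOfForm σ J)) : GL (Fin 3) K) : Matrix (Fin 3) (Fin 3) K) =
    cayley (s • (((((e γ : ↥(unitaryGroupOfForm σ J)) : GL (Fin 3) K) : Matrix (Fin 3) (Fin 3) K) - 1) * ((((e γ : ↥(unitaryGroupOfForm σ J)) : GL (Fin 3) K) : Matrix (Fin 3) (Fin 3) K) + 1)⁻¹)))

/-! ## §1 Unipotent elements and their conjugates lie in `U₀` -/

include hB hU₀ in
omit [IsUltrametricDist K] in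
/-- **A unipotent `γ ∈ G` (read through `e`) lies in `U₀`** (`0 ≤ ρ`, `2 ≠ 0`; ★ `mem_ball_of_isNilpotent`). [cite: PlatonovRapinchuk1994, §3.3] -/
theorem mem_of_isNilpotent (hρ : 0 ≤ ρ) (h2 : (2 : K) ≠ 0) {γ : G}
    (hnil : IsNilpotent ((((e γ : ↥(unitaryGroupOfForm σ J)) : GL (Fin 3) K) : Matrix (Fin 3) (Fin 3) K) - 1)) : γ ∈ U₀ :=
  (hU₀ γ).2 (mem_ball_of_isNilpotent σ J hB hρ h2 hnil)

omit [IsUltrametricDist K] in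
/-- Matrices along `e`: `mat(e(xγx⁻¹)) = mat(e x)·mat(e γ)·mat(e x)⁻¹` (as a conjugate in `GL₃`). [folklore] -/
theorem coe_map_conj (x γ : G) :
    ((e (x * γ * x⁻¹) : ↥(unitaryGroupOfForm σ J)) : GL (Fin 3) K) =
      ((e x : ↥(unitaryGroupOfForm σ J)) : GL (Fin 3) K) * ((e γ : ↥(unitaryGroupOfForm σ J)) : GL (Fin 3) K) * ((e x : ↥(unitaryGroupOfForm σ J)) : GL (Fin 3) K)⁻¹ := by
  rw [map_mul, map_mul, map_inv, Subgroup.coe_mul, Subgroup.coe_mul, Subgroup.coe_inv]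

include hB hU₀ in
omit [IsUltrametricDist K] in
/-- **Every conjugate of a unipotent `γ` lies in `U₀`** (the `hU` letter of ★ p855453 §2; ★ `isNilpotent_coe_conj_sub_one`). [cite: PlatonovRapinchuk1994, §3.3] -/
theorem conj_mem_of_isNilpotent (hρ : 0 ≤ ρ) (h2 : (2 : K) ≠ 0) {γ : G}
    (hnil : IsNilpotent ((((e γ : ↥(unitaryGroupOfForm σ J)) : GL (Fin 3) K) : Matrix (Fin 3) (Fin 3) K) - 1)) (x : G) : x * γ * x⁻¹ ∈ U₀ := by
  refine mem_of_isNilpotent hB e hU₀ hρ h2 ?_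
  rw [coe_map_conj]
  exact isNilpotent_coe_conj_sub_one _ hnil

include hB hU₀ in
omit [IsUltrametricDist K] in
/-- `1 ∈ U₀`. [cite: PlatonovRapinchuk1994, §3.3] -/
theorem one_mem (hρ : 0 ≤ ρ) (h2 : (2 : K) ≠ 0) : (1 : G) ∈ U₀ :=
  mem_of_isNilpotent hB e hU₀ hρ h2 (by rw [map_one]; exact ⟨1, by simp⟩)

include hB hU₀ in
omit [IsUltrametricDist K] in
/-- `U₀` is Ad-stable (★ `conj_mem_ball` read through `e`). [cite: PlatonovRapinchuk1994, §3.3] -/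
theorem conj_mem {γ : G} (hγ : γ ∈ U₀) (x : G) : x * γ * x⁻¹ ∈ U₀ := by
  rw [hU₀, map_mul, map_mul, map_inv]
  exact conj_mem_ball σ J hB ((hU₀ γ).1 hγ) (e x)

/-! ## §2 The model map `Ψ' = e ∘ Ψ ∘ e⁻¹` carries K2E3-p01's two-conjunct letter; equivariance (E) on `G` -/

include hB hU₀ hΨ₀ in
/-- **`Ψ' := e ∘ Ψ ∘ e⁻¹` satisfies K2E3-p01's letter `hΨ'` on `B`**: `mat(Ψ'u) = c(s•X_u)` (from `hΨ₀`) AND `mat((Ψ'u)⁻¹) = c(−s•X_u)` (the inverse of `c(Y)` is `c(−Y)`, ★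
`cayley_mul_cayley_neg`, the side conditions from ★ `isUnit_of_mem_ball` since `‖s‖ρ < 1`). [cite: PlatonovRapinchuk1994, §3.3] -/
theorem coe_map_symm_and_inv (hsρ : ‖s‖ * ρ < 1) (u : ↥(unitaryGroupOfForm σ J)) (hu : u ∈ B) :
    (((e (Ψ (e.symm u)) : ↥(unitaryGroupOfForm σ J)) : GL (Fin 3) K) : Matrix (Fin 3) (Fin 3) K) =
        cayley (s • ((((u : GL (Fin 3) K) : Matrix (Fin 3) (Fin 3) K) - 1) * (((u : GL (Fin 3) K) : Matrix (Fin 3) (Fin 3) K) + 1)⁻¹)) ∧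
    ((((e (Ψ (e.symm u)) : ↥(unitaryGroupOfForm σ J)) : GL (Fin 3) K)⁻¹ : GL (Fin 3) K) : Matrix (Fin 3) (Fin 3) K) =
        cayley (-(s • ((((u : GL (Fin 3) K) : Matrix (Fin 3) (Fin 3) K) - 1) * (((u : GL (Fin 3) K) : Matrix (Fin 3) (Fin 3) K) + 1)⁻¹))) := by
  have hu' : e.symm u ∈ U₀ := by rw [hU₀, ContinuousMulEquiv.apply_symm_apply]; exact hu
  have h1 := hΨ₀ _ hu'
  rw [ContinuousMulEquiv.apply_symm_apply] at h1
  obtain ⟨-, hm, hp⟩ := isUnit_of_mem_ball σ J hB hsρ hu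
  refine ⟨h1, ?_⟩
  rw [Matrix.coe_units_inv, h1]
  exact Matrix.inv_eq_right_inv (cayley_mul_cayley_neg hm hp)

include hB hU₀ hΨ₀ in
/-- **(E) ON `G`: `Ψ(xγx⁻¹) = x·Ψ(γ)·x⁻¹` for `γ ∈ U₀`** (the `hE` letter of ★ p855453 §2) — ★ `cayleyScaling_conj` for `Ψ' = e ∘ Ψ ∘ e⁻¹` on `B`, pulled back along `e`.
[cite: PlatonovRapinchuk1994, §3.3] [cite: HarishChandra1999AdmissibleDistributions, §3.1 Lemma 3.2] -/
theorem map_conj_eq_conj_map (hsρ : ‖s‖ * ρ < 1) {γ : G} (hγ : γ ∈ U₀) (x : G) : Ψ (x * γ * x⁻¹) = x * Ψ γ * x⁻¹ := by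
  have hΨ' := coe_map_symm_and_inv hB e hU₀ hΨ₀ hsρ
  have key := cayleyScaling_conj σ J hB (Ψ := fun u => e (Ψ (e.symm u))) hΨ' hsρ ((hU₀ γ).1 hγ) (e x)
  simp only [← map_mul, ← map_inv, ContinuousMulEquiv.symm_apply_apply] at key
  exact e.injective key

/-! ## §3 `Ψ 1 = 1`, and (i′) ⟹ `e (Ψ u₀) = h′·e u₀·h′⁻¹` -/

include hB hU₀ hΨ₀ in
omit [IsUltrametricDist K] in
/-- **`Ψ 1 = 1`**: `mat(e(Ψ 1)) = c(s • X_1) = c(0) = 1 = mat(e 1)`. [cite: PlatonovRapinchuk1994, §3.3] -/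
theorem map_one_eq_one (hρ : 0 ≤ ρ) (h2 : (2 : K) ≠ 0) : Ψ 1 = 1 := by
  have h1 := hΨ₀ 1 (one_mem hB e hU₀ hρ h2)
  rw [map_one, show (((1 : ↥(unitaryGroupOfForm σ J)) : GL (Fin 3) K) : Matrix (Fin 3) (Fin 3) K) = 1 from rfl, sub_self, Matrix.zero_mul,
    smul_zero, cayley_def, add_zero, sub_zero, inv_one, Matrix.mul_one] at h1
  apply e.injective
  rw [map_one]
  exact Subtype.ext (Units.ext h1)

include hΨ₀ in
omit [IsUltrametricDist K] in
/-- **(i′) ⟹ the `hΨ'` letter of the transport**: if `u₀ ∈ U₀` and `mat(h′·e u₀·h′⁻¹) = c(s • X_{e u₀})` (the C1∕C2 heads, `s = t·t`), then `e (Ψ u₀) = h′·e u₀·h′⁻¹`.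
[cite: HarishChandra1999AdmissibleDistributions, §3.1 Lemma 3.2] -/
theorem map_eq_conj_of_coe_conj_eq {u₀ : G} (hu₀ : u₀ ∈ U₀) {h' : ↥(unitaryGroupOfForm σ J)}
    (hmat : (((h' * e u₀ * h'⁻¹ : ↥(unitaryGroupOfForm σ J)) : GL (Fin 3) K) : Matrix (Fin 3) (Fin 3) K) =
      cayley (s • (((((e u₀ : ↥(unitaryGroupOfForm σ J)) : GL (Fin 3) K) : Matrix (Fin 3) (Fin 3) K) - 1) * ((((e u₀ : ↥(unitaryGroupOfForm σ J)) : GL (Fin 3) K) : Matrix (Fin 3) (Fin 3) K) + 1)⁻¹))) :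
    e (Ψ u₀) = h' * e u₀ * h'⁻¹ :=
  Subtype.ext (Units.ext (by rw [hΨ₀ u₀ hu₀, hmat]))

end Model

/-! ## §4 The identity class: `Φ_m([1], 1_{U₀}·(F∘Ψ)) = Φ_m([1], F)` -/

section IdentityClass

variable {G : Type*} [Group G] [∀ γ : G, MeasurableSpace (G ⧸ Subgroup.centralizer ({γ} : Set G))]

omit [∀ γ : G, MeasurableSpace (G ⧸ Subgroup.centralizer ({γ} : Set G))] in
/-- The representative of the identity class is `1`. [folklore] -/
theorem out_mk_one_eq_one : (Quotient.out (ConjClasses.mk (1 : G)) : G) = 1 := by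
  have h : ConjClasses.mk (Quotient.out (ConjClasses.mk (1 : G)) : G) = ConjClasses.mk 1 := by
    rw [← ConjClasses.quotient_mk_eq_mk, Quotient.out_eq]
  exact isConj_one_right.1 (ConjClasses.mk_eq_mk_iff_isConj.1 h).symm

/-- **At the identity class the scaling does nothing**: if `Ψ 1 = 1` and `1 ∈ U₀` then `Φ_m([1], 1_{U₀}·(F∘Ψ)) = Φ_m([1], F)` — the orbit of `1` is `{1}` and both integrands are
the constant `F 1` (exponent `a [1] = 0` of ‹SC-explicit›). [cite: Rogawski1990, §4.9 p. 54] -/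
theorem classOrbitalIntegral_indicator_comp_eq_of_mk_one {Ψ : G → G} (hΨ1 : Ψ 1 = 1) {U₀ : Set G} (h1 : (1 : G) ∈ U₀)
    (m : OrbitalMeasureFamily G) (F : G → ℂ) :
    classOrbitalIntegral m (U₀.indicator (F ∘ Ψ)) (ConjClasses.mk 1) = classOrbitalIntegral m F (ConjClasses.mk 1) := by
  rw [classOrbitalIntegral_eq, classOrbitalIntegral_eq, orbitalIntegral_eq_integral_descConj, orbitalIntegral_eq_integral_descConj]
  congr 1
  funext y
  induction y using QuotientGroup.induction_on with
  | H g =>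
    rw [descConj_mk, descConj_mk]
    have hg : g * (Quotient.out (ConjClasses.mk (1 : G)) : G) * g⁻¹ = 1 := by rw [out_mk_one_eq_one, mul_one, mul_inv_cancel]
    rw [hg, Set.indicator_of_mem h1, Function.comp_apply, hΨ1]

end IdentityClass

/-! ## §5 C2's (i′) in the `hJ`-letter shape (the ★ statement is typed at the literal split form `J₀`) -/

section RegularLetter

variable {K : Type*} [Field K] (σ : K →+* K)

/-- **C2 (i′) + `hZ` with a letter `hJ : J = J₀`** (★ p855548 `exists_conj_coe_eq_cayley_smul_of_regular_unipotent`, whose carrier is typed at the literal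
`(StdForm.antidiagonal 3).over K`; here for any `J` propositionally equal to it, e.g. `placeForm (qsForm L) w.1`). [cite: Rogawski1990, Proposition 3.9.1 p. 32]
[cite: HarishChandra1999AdmissibleDistributions, §3.1 Lemma 3.2] -/
theorem exists_conj_coe_eq_cayley_smul_of_regular_unipotent_of_eq {J : Matrix (Fin 3) (Fin 3) K} (hJ : J = (StdForm.antidiagonal 3).over K)
    (hσ : ∀ z : K, σ (σ z) = z) (h2 : (2 : K) ≠ 0) {s : K} (hσs : σ s = s) (hs0 : s ≠ 0) (u₀ : ↥(unitaryGroupOfForm σ J))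
    (h3 : (((u₀ : GL (Fin 3) K) : Matrix (Fin 3) (Fin 3) K) - 1) ^ 3 = 0) (hreg : (((u₀ : GL (Fin 3) K) : Matrix (Fin 3) (Fin 3) K) - 1) ^ 2 ≠ 0) :
    ∃ h : ↥(unitaryGroupOfForm σ J),
      (((h * u₀ * h⁻¹ : ↥(unitaryGroupOfForm σ J)) : GL (Fin 3) K) : Matrix (Fin 3) (Fin 3) K) = cayley (s • ((((u₀ : GL (Fin 3) K) : Matrix (Fin 3) (Fin 3) K) - 1) * (((u₀ : GL (Fin 3) K) : Matrix (Fin 3) (Fin 3) K) + 1)⁻¹)) ∧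
      ∀ z : ↥(unitaryGroupOfForm σ J),
        z ∈ Subgroup.centralizer ({u₀} : Set ↥(unitaryGroupOfForm σ J)) ↔ h * z * h⁻¹ ∈ Subgroup.centralizer ({u₀} : Set ↥(unitaryGroupOfForm σ J)) := by
  subst hJ
  exact K2E3UnipotentOrbitalScalingRegular.exists_conj_coe_eq_cayley_smul_of_regular_unipotent σ hσ h2 hσs hs0 u₀ h3 hreg

end RegularLetter

end Summit.HodgeConjecture.HodgeConjecture.Cruxes.H413.K2E3UnipotentOrbitalScalingLawPrelims

end
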